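import Mathlib
import Literature.MathematicalPhysics.QuantumFieldTheory.Balaban1983to89.B1Eq324BenfattoLemma
import Literature.MathematicalPhysics.QuantumFieldTheory.Balaban1983to89.B1Eq324BenfattoAppendixA
import Literature.MathematicalPhysics.QuantumFieldTheory.Balaban1983to89.B10

/-!
# `Balaban1983to89.B1Eq324BenfattoSpecialisation` — the citing sentence of [Balaban1982Higgs1] (3.24) p. 616 over the
# typed Lemma of [BenfattoEtAl1978] p. 152: the `ε`-BOOKKEEPING of the printed error term (which power of the small
# parameter the remainder of the truncated cumulant expansion actually is, for coefficients `∝ ε^{1/2}` and field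
# thresholds `p(ε) = b₀(1 + log ε⁻¹)^{p₀}`), the log-sandwich (4.6)∅ ∧ (4.7), and the small-field volume (A.1)–(A.2)
# in the same currency — PROVED real analysis over the objects of `…B1Eq324BenfattoLemma`; no new definition, no fact asserted

statement-level companion of a published source with citation tags; every declaration here is a theorem; nothing here is
a claim about the Yang–Mills mass gap; the Lemma of p. 152 of [BenfattoEtAl1978] is NOT asserted (its inequalities enter as
explicit hypotheses for given constants), its Appendix A lemma is USED as the tree theorem it now is

WHY THIS MODULE (cell `pub-ymgap`, seat `dag-n08-d` gen 7, node N08 = [Balaban1985UV3] Thm 2 (41)/(47); lane K1⁗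
`--supports stmt-QuantumFields-20290`, count-neutral).  The first missing estimate of [Balaban1985UV3] Thm 2's proof in printed
order is the cumulant remainder bound behind (24) p. 262 / (58) p. 270 = [Balaban1982Higgs1] (3.24)(c) p. 616 (hypothesis shape
`B10Eq24Cumulant.FluctuationModel.CumulantRemainderBound`; row `h324c` of the d = 3 lane's (α) data schema), which B1 proves
only by reference: *"Instead we will rely on the results of Benfatto et al. [2]. The lemma formulated on p. 152 of this paper
can be applied in our situation because all the assumptions are satisfied."*  The source is now typed AS PRINTED
(`…B1Eq324BenfattoLemma`: the free field `P0`, the Hamiltonians (4.5) `hamiltonian`, `A ≡ sup|coeff|` = `coefSup`, the cut-off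
`smallFieldSet` / `cutoffBoltzmann`, the truncated expectations `truncatedExp` / `cumulantSum`, the error per unit volume
`errTerm S ρ₁ ρ₂ ρ₃ ρ₄ A b t = S((Ab^{ρ₁}e^{ρ₂Ab^{ρ₃}})^{t+1} + e^{−ρ₃b^{3/2}}e^{ρ₄Ab^{ρ₃}})`, (4.6) `Ineq46`, (4.7) `Ineq47`, the
named facts `BasicLemmaPrinted`, `AppendixALemmaPrinted`), and its header records what it leaves out: *"B1's O(ε^κ)|T₁| is
what this becomes for A ∝ ε^{1/2} and b a power of log ε⁻¹ (that specialisation is B1's sentence, not typed here)."*  This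
module types AND PROVES that sentence — the in-edge's conclusion in the consumer's currency — together with the exponent
bookkeeping B1 states in words (*"The coefficients of the polynomial V are proportional to some positive powers of ε. The
smallest such power is ε^{1/2} … Hence ⟨Vⁿ⟩ᵀ = O(εᵏ)|T₁| with κ > d for n sufficiently large, e.g. n > 6"*, p. 616) and
[Balaban1985UV3] uses as *"up to the sixth order (or higher) in g₀"* (p. 261).

WHAT IS PROVED (all [folklore] real analysis or compositions of the typed displays; `η` is the small parameter — B1's `ε`
with `σ = 1/2`, or B10's running coupling `g_k` with `σ = 1` — and the threshold is the tree's `B10.pFun b₀ p₀ η =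
b₀(1 + log η⁻¹)^{p₀}`, (7) p. 257 of [Balaban1985UV3]; B1's `p(ε)` has the same form).
* §1 growth of the threshold: `(1 + log η⁻¹)^q ≦ K·η^{−δ}` on `(0, 1]` for every real `q` and `δ > 0`
  (`exists_one_add_log_inv_rpow_le`) and its printed instance `seventh_order_threshold_le` = the COUPLING-POWER half of p. 262
  line 1 of [Balaban1985UV3], *"O(g₀⁷p¹⁸(g₀))|Ω₁| ≦ O(ε^{3+κ₀})|T₁|"*: `g₀⁷p(g₀)¹⁸ ≦ C·g₀^{6+2κ₀}` on `(0, 1]` for every `κ₀ < 1/2`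
  (the volume factor `|Ω₁| ≦ |T₁|` of that display is not typed here — referee ref-G READ121); `p(η) > 0`,
  `p(η)^ρ = b₀^ρ(1 + log η⁻¹)^{p₀ρ}`, `p(η)²`; private plumbing: `1 ≦ 1 + log η⁻¹`, `(1 + log η⁻¹)^a ≧ M` near `0` (`a > 0`),
  `e^{−Q} ≦ η^κ` once `κ(1 + log η⁻¹) ≦ Q`.
* §2 the error term: `errTerm ≧ 0`; its value `S·e^{−ρ₃b^{3/2}}` at `A = 0`; ★ **LOCATED** `le_errTerm_of_rho3_nonpos`: for
  `ρ₃ ≦ 0` the error at `A = 0` is `≧ S` for EVERY `b` — it does not decay as `b → ∞`.  The typed `BasicLemma d α β` quantifies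
  `∃ S ρ₁ ρ₂ ρ₃ ρ₄ : ℝ` with NO sign, while print's Remark 4 p. 152 (*"the above lemma is very weak from the point of view of
  statistical mechanics and becomes interesting only in the limit A → 0 b → ∞"*) presupposes `ρ₃ > 0` (and (4.7) at `H_J = 0`
  forces `S > 0` since `P̂₀(Πχ̂) < 1` — §7, v1.1).  CONSEQUENCE: B1's `O(ε^κ)` sentence cannot be READ
  OFF `BasicLemmaPrinted` as typed — a consumer holding it as a hypothesis obtains constants of unknown sign (`exists_consts_of_basicLemma`),
  for which the printed error need not decay; the theorems below therefore take the constants of (4.6)–(4.7) EXPLICITLY with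
  `0 ≦ S`, `0 < ρ₃` (repair for the typer, not made here: record `0 < ρ₃ ∧ 0 ≦ S` inside `BasicLemma`).
* §3 ★★ `errTerm_pFun_le` — THE SPECIALISATION: `0 ≦ S`, `0 < ρ₃`, `0 < b₀`, `p₀ > 2/3`, `0 < σ`, `0 ≦ c`, `0 < κ < σ(t+1)` ⇒
  `∃ η₀ ∈ (0,1], C ≧ 0, ∀ η ∈ (0, η₀], ∀ A ∈ [0, c·η^σ]: errTerm S ρ₁ ρ₂ ρ₃ ρ₄ A p(η) t ≦ C·η^κ` (`ρ₁, ρ₂, ρ₄` ANY reals: the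
  power term is `O(η^{σ(t+1)})` up to logarithms, the large-field term `e^{−ρ₃p(η)^{3/2}}` beats every power iff `3p₀/2 > 1`);
  `errTerm_pFun_le_seven`: `σ = 1/2`, `t = n̄ = 6` ⇒ `O(η^{13/4})`, `13/4 > 3 = d` — B1's *"e.g. n > 6"* for d = 3, certified —
  and `errTerm_pFun_le_five`: `t = 4` ⇒ `O(η^{9/4})`, `9/4 > 2` (d = 2).
* §4 two facts about [2]'s objects the consumer needs: `coefSup_nonneg` / `abs_coef_le_coefSup` (the index range of (4.5) is
  finite: `bddAbove_coefSet`), and `abs_log_integral_sub_cumulantSum_le`: (4.6) at `C = ∅` (where `P̄ = P̂₀`, `condField_empty`)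
  ∧ (4.7) ⇒ `0 < ∫Πχ̂e^{H_J}dP̂₀` and `|log ∫Πχ̂e^{H_J}dP̂₀ − Σ_{k=1}^{t}ℰ̂₀^T(H_J;k)/k!| ≦ |I|·errTerm` = (3.24) in OUTPUT form.
* §5 `exists_consts_of_basicLemma` (what the typed fact hands over: constants, no signs); ★★ `eq324_of_basicLemma_consts` —
  B1 (3.24) IN [2]'s CURRENCY: if `b*, S ≧ 0, ρ₁, ρ₂, ρ₃ > 0, ρ₄` satisfy (4.6) ∧ (4.7) at
  `(t, D, ϰ)` (the body of `BasicLemma` for one choice of constants), then for every `κ < σ(t+1)`: `∃ η₀ C, ∀ η ∈ (0, η₀],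
  ∀ s, I ⊇ J ≠ ∅, a` with `coefSup ≦ c·η^σ`: `|log ∫Πχ̂_{p(η)}e^{H_J}dP̂₀ − Σ_{k≦t}ℰ̂₀^T/k!| ≦ C·η^κ·|I|` (the threshold condition
  `p(η) > b*` is built into `η₀`); `eq324_of_basicLemma_consts_seven` (`t = 6`, `σ = 1/2`, `κ = 13/4`).
* §6 `log_smallFieldSet_ge_of_appendixA_consts`: (A.1)–(A.2) with explicit `b̄`, `k₁ ≧ 0`, `k₂ > 0` and `p₀ > 1/2` ⇒ for every
  `κ > 0`, near `η = 0`: `P̂₀(Πχ̂_{p(η)}) > 0` and `log P̂₀(Πχ̂_{p(η)}) ≧ −|I|·k₁·η^κ` — the `−W`, `W = O(εᵏ)|T₁|`, small-field-VOLUME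
  input of the LOWER half of (3.24) (the hypothesis shape `B10Eq24Cumulant.FluctuationModel.SmallFieldVolume`), in `η`-currency;
  ★ `log_smallFieldSet_P0_ge` — the same UNCONDITIONALLY for [2]'s free field (every `d`, `α, β > 0`; `k₁ = 4·8^d`), by the tree's
  PROOF of Appendix A (`B1Eq324BenfattoAppendixA.appendixA_explicit`, seat dag-n08-b, p522583).
* §7 (v1.1) the sign of `S` IS forced: `P0_real_smallFieldSet_lt_one` (`P̂₀(Π_Δχ̂_Δ) < 1` for `α, β > 0`, `I ≠ ∅`, any `b`:
  one coordinate is a non-degenerate Gaussian) and ★ `S_pos_of_ineq47_zero` ((4.7) for the zero coefficient family ⇒ `0 < S`);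
  plumbing `hamiltonian_zero`, `coefSup_zero`, `cumulantOf_eq_zero_of_moments_eq_zero`, `cumulantSum_zero`,
  `integral_cutoffBoltzmann_zero`.  So the typed inequalities DETERMINE the sign of `S`, NOT that of `ρ₃`.

WHAT IS NOT CLAIMED.  The Lemma of p. 152 of [BenfattoEtAl1978] (its inequalities enter as hypotheses for GIVEN constants;
`BasicLemmaPrinted` stays a named fact — §5 pp. 153–159 of [2] is other seats' work; Appendix A IS a tree theorem and §6 uses it); the identification of B1's / B10's fluctuation integrals
`∫dμ_{C^{(k)}}χ exp[…]` with instances of [2]'s free field (1.1) and Hamiltonians (4.5) (B1's *"all the assumptions are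
satisfied"* — [2]'s field is the nearest-neighbour Gaussian Markov field, its truncated expectations are the UNCONDITIONAL
Gaussian ones, its thresholds grow away from `I`; see the header of `…B1Eq324BenfattoLemma`); any instance of
`B10Eq24Cumulant.FluctuationModel.CumulantRemainderBound` (a bound on TILTED cumulants under the χ-weighted law — a different
intermediate object than [2]'s output sandwich; the d = 3 lane already proves the two cuts interchangeable and has the output-form cut
`Summit.QuantumFields.Balaban3D.Proofs.cumulant58_of_eq324_model` / `eq324_of_lqb_leaves` (`Cumulant324.lean`), while the χ-weighted vs
unconditional cumulant currency remains inside the localisation leaf); d = 4.  Count-neutral for N08: `Node00.PrintedUV3V` untouched.  Value =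
the by-reference DAG edge B10 (24)/(58) ← B1 (3.24) ← [2] p. 152 now has its `ε`-bookkeeping kernel-certified: WHICH exponents
the printed error term delivers (`κ < σ(t+1)`, so `n̄ = 6` is exactly what makes `κ > 3` available at `σ = 1/2`), under WHICH
signs of the printed constants, and what the typed fact must record for B1's sentence to follow.

## References
* [BenfattoEtAl1978] G. Benfatto, M. Cassandro, G. Gallavotti, F. Nicolò, E. Olivieri, E. Presutti, E. Scacciatelli, *Some
  probabilistic techniques in field theory*, Commun. Math. Phys. 59 (1978) 143–166 — Lemma (4.5)–(4.7) and Remark 4 p. 152,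
  Appendix A Lemma (A.1)–(A.2) p. 161 (typed in `…B1Eq324BenfattoLemma`, whose quotations are relied on; no new page read).
* [Balaban1982Higgs1] T. Bałaban, *(Higgs)₂,₃ quantum fields in a finite volume I. A lower bound*, Commun. Math. Phys. 85
  (1982) 603–636 — (3.23)–(3.24) and the citing sentence, p. 616 (quoted in `…B10Eq24Cumulant`).
* [Balaban1985UV3] T. Bałaban, *Ultraviolet stability of three-dimensional lattice pure gauge field theories*, Commun. Math.
  Phys. 102 (1985) 255–275 — (7) p. 257 (`p(g) = b₀(1 + log g⁻¹)^{p₀}`, `p₀ > 2`: the tree's `B10.pFun`), p. 261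
  («up to the sixth order»), (24) p. 262, (58) p. 270.
-/

noncomputable section

open MeasureTheory Finset

namespace Literature.MathematicalPhysics.QuantumFieldTheory.Balaban1983to89.B1Eq324BenfattoSpecialisation

open B1Eq324BenfattoLemma

/-! ## §1  Growth of the field threshold `p(η) = b₀(1 + log η⁻¹)^{p₀}` as `η → 0⁺` -/

/-- On `(0, 1]` the logarithmic factor `1 + log η⁻¹` is at least `1` (private plumbing). [folklore] -/
private theorem one_le_one_add_log_inv {η : ℝ} (hη : 0 < η) (hη1 : η ≤ 1) : 1 ≤ 1 + Real.log η⁻¹ := by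
  have := B10.log_inv_nonneg_of_le_one hη hη1
  linarith

/-- **A power of the logarithmic threshold factor costs an arbitrarily small power of the small parameter** — the engine
of print's *"O(g₀⁷p¹⁸(g₀))|Ω₁| ≦ O(ε^{3+κ₀})|T₁|"* (p. 262 line 1; `seventh_order_threshold_le` below is that line): for every real
`q` and `δ > 0` there is `K > 0` with `(1 + log η⁻¹)^q ≦ K·η^{−δ}` on `(0, 1]` (for `q ≦ 0` take `K = 1`; for `q > 0` use
`log u ≦ u^ε/ε` with `ε = δ/q`, `u = η⁻¹`). [cite: Balaban1985UV3, p.262 l.1] -/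
theorem exists_one_add_log_inv_rpow_le (q : ℝ) {δ : ℝ} (hδ : 0 < δ) :
    ∃ K : ℝ, 0 < K ∧ ∀ η : ℝ, 0 < η → η ≤ 1 → (1 + Real.log η⁻¹) ^ q ≤ K * η ^ (-δ) := by
  rcases le_or_gt q 0 with hq | hq
  · refine ⟨1, one_pos, fun η hη hη1 => ?_⟩
    have hℓ := one_le_one_add_log_inv hη hη1
    have h1 : (1 + Real.log η⁻¹) ^ q ≤ 1 := Real.rpow_le_one_of_one_le_of_nonpos hℓ hq
    have h2 : (1 : ℝ) ≤ η ^ (-δ) := Real.one_le_rpow_of_pos_of_le_one_of_nonpos hη hη1 (by linarith)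
    linarith
  · set ε : ℝ := δ / q with hε
    have hεpos : 0 < ε := div_pos hδ hq
    refine ⟨(1 + 1 / ε) ^ q, Real.rpow_pos_of_pos (by positivity) q, fun η hη hη1 => ?_⟩
    have hu1 : (1 : ℝ) ≤ η⁻¹ := one_le_inv_iff₀.mpr ⟨hη, hη1⟩
    have hu0 : (0 : ℝ) ≤ η⁻¹ := zero_le_one.trans hu1
    have hlog : Real.log η⁻¹ ≤ (η⁻¹) ^ ε / ε := Real.log_le_rpow_div hu0 hεpos
    have hone : (1 : ℝ) ≤ (η⁻¹) ^ ε := Real.one_le_rpow hu1 hεpos.le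
    have hℓ : 1 + Real.log η⁻¹ ≤ (1 + 1 / ε) * (η⁻¹) ^ ε := by
      have : (1 + 1 / ε) * (η⁻¹) ^ ε = (η⁻¹) ^ ε + (η⁻¹) ^ ε / ε := by ring
      rw [this]
      exact add_le_add hone hlog
    have hℓ0 : 0 ≤ 1 + Real.log η⁻¹ := zero_le_one.trans (one_le_one_add_log_inv hη hη1)
    calc (1 + Real.log η⁻¹) ^ q ≤ ((1 + 1 / ε) * (η⁻¹) ^ ε) ^ q := Real.rpow_le_rpow hℓ0 hℓ hq.le
      _ = (1 + 1 / ε) ^ q * ((η⁻¹) ^ ε) ^ q := Real.mul_rpow (by positivity) (by positivity)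
      _ = (1 + 1 / ε) ^ q * η ^ (-δ) := by
          congr 1
          rw [← Real.rpow_mul hu0, Real.inv_rpow hη.le, ← Real.rpow_neg hη.le]
          congr 1
          rw [hε]
          field_simp

/-- **The logarithmic factor exceeds any level near `η = 0`**: for `a > 0` and every `M` there is `η₀ ∈ (0, 1]` with
`M ≤ (1 + log η⁻¹)^a` for all `η ∈ (0, η₀]` (private plumbing). [folklore] -/
private theorem exists_le_one_add_log_inv_rpow {a : ℝ} (ha : 0 < a) (M : ℝ) :
    ∃ η₀ : ℝ, 0 < η₀ ∧ η₀ ≤ 1 ∧ ∀ η : ℝ, 0 < η → η ≤ η₀ → M ≤ (1 + Real.log η⁻¹) ^ a := by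
  set L : ℝ := (max M 1) ^ (1 / a) with hL
  have hL1 : 1 ≤ L := by
    rw [hL]
    exact Real.one_le_rpow (le_max_right _ _) (by positivity)
  refine ⟨Real.exp (1 - L), Real.exp_pos _, ?_, fun η hη hηL => ?_⟩
  · exact Real.exp_le_one_iff.mpr (by linarith)
  · have hℓ : L ≤ 1 + Real.log η⁻¹ := by
      have h1 : Real.log η ≤ 1 - L := by
        rw [← Real.log_exp (1 - L)]
        exact Real.log_le_log hη hηL
      rw [Real.log_inv]
      linarith
    have hL0 : 0 ≤ L := zero_le_one.trans hL1
    calc M ≤ max M 1 := le_max_left _ _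
      _ = L ^ a := by
          rw [hL, ← Real.rpow_mul (le_trans zero_le_one (le_max_right _ _))]
          rw [one_div_mul_cancel ha.ne', Real.rpow_one]
      _ ≤ (1 + Real.log η⁻¹) ^ a := Real.rpow_le_rpow hL0 hℓ ha.le

/-- **An exponentially small quantity is below a power**: if `κ·(1 + log η⁻¹) ≤ Q` (`κ ≥ 0`, `η > 0`) then
`e^{−Q} ≤ η^κ` (indeed `η^κ = e^{κ − κ(1 + log η⁻¹)}`; private plumbing). [folklore] -/
private theorem exp_neg_le_rpow {η κ Q : ℝ} (hη : 0 < η) (hκ : 0 ≤ κ) (hQ : κ * (1 + Real.log η⁻¹) ≤ Q) :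
    Real.exp (-Q) ≤ η ^ κ := by
  have hηκ : η ^ κ = Real.exp (κ - κ * (1 + Real.log η⁻¹)) := by
    rw [Real.rpow_def_of_pos hη, Real.log_inv]
    congr 1
    ring
  rw [hηκ]
  exact Real.exp_le_exp.mpr (by linarith)

/-- The threshold `p(η) = b₀(1 + log η⁻¹)^{p₀}` is positive on `(0, 1]` for `b₀ > 0`. [cite: Balaban1985UV3, (7) p.257] -/
theorem pFun_pos_of_le_one {b₀ p₀ η : ℝ} (hb₀ : 0 < b₀) (hη : 0 < η) (hη1 : η ≤ 1) : 0 < B10.pFun b₀ p₀ η := by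
  unfold B10.pFun
  exact mul_pos hb₀ (Real.rpow_pos_of_pos (lt_of_lt_of_le zero_lt_one (one_le_one_add_log_inv hη hη1)) _)

/-- Powers of the threshold: `p(η)^ρ = b₀^ρ·(1 + log η⁻¹)^{p₀ρ}` on `(0, 1]` (`b₀ > 0`). [cite: Balaban1985UV3, (7) p.257] -/
theorem pFun_rpow_eq {b₀ p₀ η : ℝ} (hb₀ : 0 < b₀) (hη : 0 < η) (hη1 : η ≤ 1) (ρ : ℝ) :
    B10.pFun b₀ p₀ η ^ ρ = b₀ ^ ρ * (1 + Real.log η⁻¹) ^ (p₀ * ρ) := by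
  have hℓ0 : 0 ≤ 1 + Real.log η⁻¹ := zero_le_one.trans (one_le_one_add_log_inv hη hη1)
  unfold B10.pFun
  rw [Real.mul_rpow hb₀.le (Real.rpow_nonneg hℓ0 _), Real.rpow_mul hℓ0]

/-- The square of the threshold: `p(η)² = b₀²·(1 + log η⁻¹)^{2p₀}` on `(0, 1]`. [cite: Balaban1985UV3, (7) p.257] -/
theorem pFun_sq_eq (b₀ : ℝ) {p₀ η : ℝ} (hη : 0 < η) (hη1 : η ≤ 1) :
    B10.pFun b₀ p₀ η ^ 2 = b₀ ^ 2 * (1 + Real.log η⁻¹) ^ (2 * p₀) := by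
  have hℓ0 : 0 ≤ 1 + Real.log η⁻¹ := zero_le_one.trans (one_le_one_add_log_inv hη hη1)
  unfold B10.pFun
  rw [mul_pow, ← Real.rpow_mul_natCast hℓ0 p₀ 2]
  congr 1
  congr 1
  push_cast
  ring

/-- **p. 262 line 1 of [Balaban1985UV3]: «O(g₀⁷p¹⁸(g₀))|Ω₁| ≦ O(ε^{3+κ₀})|T₁|»** — the seventh-order Taylor remainder with
eighteen powers of the threshold `p(g₀) = b₀(1 + log g₀⁻¹)^{p₀}` is of order `g₀^{6+2κ₀} = g^{6+2κ₀}ε^{3+κ₀}` (`g₀² = g²ε` by (1))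
for EVERY `κ₀ < 1/2`, uniformly on `g₀ ∈ (0, 1]`: `g₀⁷·p(g₀)¹⁸ ≦ C·g₀^{6+2κ₀}` (print fixes no value of `κ₀`; `1/2` is the room the
line leaves). [cite: Balaban1985UV3, p.262 l.1] -/
theorem seventh_order_threshold_le {b₀ p₀ κ₀ : ℝ} (hb₀ : 0 < b₀) (hκ₀ : κ₀ < 1 / 2) :
    ∃ C : ℝ, 0 ≤ C ∧ ∀ g₀ : ℝ, 0 < g₀ → g₀ ≤ 1 →
      g₀ ^ 7 * B10.pFun b₀ p₀ g₀ ^ 18 ≤ C * g₀ ^ (6 + 2 * κ₀) := by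
  obtain ⟨K, hKpos, hK⟩ := exists_one_add_log_inv_rpow_le (p₀ * 18) (by linarith : 0 < 1 - 2 * κ₀)
  refine ⟨b₀ ^ (18 : ℝ) * K, by positivity, fun g₀ hg hg1 => ?_⟩
  have hp : B10.pFun b₀ p₀ g₀ ^ 18 = b₀ ^ (18 : ℝ) * (1 + Real.log g₀⁻¹) ^ (p₀ * 18) := by
    rw [← Real.rpow_natCast (B10.pFun b₀ p₀ g₀) 18, Nat.cast_ofNat, pFun_rpow_eq hb₀ hg hg1 18]
  have h7 : g₀ ^ 7 = g₀ ^ (7 : ℝ) := by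
    rw [← Real.rpow_natCast g₀ 7, Nat.cast_ofNat]
  have hsplit : g₀ ^ (7 : ℝ) * g₀ ^ (-(1 - 2 * κ₀)) = g₀ ^ (6 + 2 * κ₀) := by
    rw [← Real.rpow_add hg]
    congr 1
    ring
  rw [hp, h7]
  calc g₀ ^ (7 : ℝ) * (b₀ ^ (18 : ℝ) * (1 + Real.log g₀⁻¹) ^ (p₀ * 18))
      ≤ g₀ ^ (7 : ℝ) * (b₀ ^ (18 : ℝ) * (K * g₀ ^ (-(1 - 2 * κ₀)))) :=
        mul_le_mul_of_nonneg_left (mul_le_mul_of_nonneg_left (hK g₀ hg hg1) (Real.rpow_nonneg hb₀.le _))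
          (Real.rpow_nonneg hg.le _)
    _ = b₀ ^ (18 : ℝ) * K * (g₀ ^ (7 : ℝ) * g₀ ^ (-(1 - 2 * κ₀))) := by ring
    _ = b₀ ^ (18 : ℝ) * K * g₀ ^ (6 + 2 * κ₀) := by rw [hsplit]

/-! ## §2  Elementary calculus of the printed error term `S((Ab^{ρ₁}e^{ρ₂Ab^{ρ₃}})^{t+1} + e^{−ρ₃b^{3/2}}e^{ρ₄Ab^{ρ₃}})` -/

/-- The error term of (4.6)–(4.7) is nonnegative for `S ≥ 0`, `A ≥ 0`, `b ≥ 0`. [cite: BenfattoEtAl1978, (4.6)–(4.7) p.152] -/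
theorem errTerm_nonneg {S A b : ℝ} (ρ₁ ρ₂ ρ₃ ρ₄ : ℝ) (t : ℕ) (hS : 0 ≤ S) (hA : 0 ≤ A) (hb : 0 ≤ b) :
    0 ≤ errTerm S ρ₁ ρ₂ ρ₃ ρ₄ A b t := by
  unfold errTerm
  have h1 : 0 ≤ b ^ ρ₁ := Real.rpow_nonneg hb _
  positivity

/-- At `A = 0` (no interaction, `H_J = 0`) the error term is `S·e^{−ρ₃b^{3/2}}`. [cite: BenfattoEtAl1978, (4.6)–(4.7) p.152] -/
theorem errTerm_zero_A (S ρ₁ ρ₂ ρ₃ ρ₄ b : ℝ) (t : ℕ) :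
    errTerm S ρ₁ ρ₂ ρ₃ ρ₄ 0 b t = S * Real.exp (-(ρ₃ * b ^ (3 / 2 : ℝ))) := by
  unfold errTerm
  simp

/-- **LOCATED (typing of the named fact).**  If `ρ₃ ≤ 0` the error term does NOT decay as `b → ∞`: already at `A = 0` it is
`≥ S` for EVERY threshold `b ≥ 0`.  The typed `BasicLemma` quantifies `∃ S ρ₁ ρ₂ ρ₃ ρ₄ : ℝ` with no sign recorded, whereas the
print's Remark 4 p. 152 («the above lemma … becomes interesting only in the limit A → 0 b → ∞») presupposes `ρ₃ > 0`; hence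
the `O(ε^κ)` specialisation of [Balaban1982Higgs1] p. 616 cannot be read off `BasicLemmaPrinted` as typed (its `∃ S ρ₁ ρ₂ ρ₃ ρ₄`
transmits no sign, `exists_consts_of_basicLemma`), and the theorems of §3–§5 take the constants explicitly with `0 < ρ₃`, `0 ≤ S`.
[cite: BenfattoEtAl1978, Remark 4 p.152] -/
theorem le_errTerm_of_rho3_nonpos {S ρ₃ b : ℝ} (ρ₁ ρ₂ ρ₄ : ℝ) (t : ℕ) (hS : 0 ≤ S) (hρ₃ : ρ₃ ≤ 0) (hb : 0 ≤ b) :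
    S ≤ errTerm S ρ₁ ρ₂ ρ₃ ρ₄ 0 b t := by
  rw [errTerm_zero_A]
  have h1 : (1 : ℝ) ≤ Real.exp (-(ρ₃ * b ^ (3 / 2 : ℝ))) := by
    have : ρ₃ * b ^ (3 / 2 : ℝ) ≤ 0 := mul_nonpos_of_nonpos_of_nonneg hρ₃ (Real.rpow_nonneg hb _)
    exact Real.one_le_exp (by linarith)
  nlinarith

/-! ## §3  THE SPECIALISATION: `A ≤ c·η^σ`, `b = p(η) = b₀(1 + log η⁻¹)^{p₀}` ⇒ error `O(η^κ)` for every `κ < σ(t+1)` -/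

/-- **B1's sentence about the error term of [2] p. 152** («The coefficients of the polynomial V are proportional to some
positive powers of ε. The smallest such power is ε^{1/2} … ⟨Vⁿ⟩ᵀ = O(εᵏ)|T₁| with κ > d for n sufficiently large», p. 616; [2]
Remark 4 p. 152 «interesting only in the limit A → 0 b → ∞»): with the coefficient bound `0 ≤ A ≤ c·η^σ` and the field threshold
`b = p(η) = b₀(1 + log η⁻¹)^{p₀}` ((7) p. 257 of [Balaban1985UV3]; B1's `p(ε)`), the printed error per unit volume satisfies
`errTerm ≤ C·η^κ` on `(0, η₀]` for EVERY `0 < κ < σ(t+1)` — the `(t+1)`-st power term is `O(η^{σ(t+1)})` up to logarithms and the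
large-field term `e^{−ρ₃b^{3/2}}` beats every power of `η` because `3p₀/2 > 1`.  Hypotheses: `0 ≤ S`, `0 < ρ₃` (see
`le_errTerm_of_rho3_nonpos`), `0 < b₀`, `2/3 < p₀` (print: `p₀ > 2`), `0 < σ`, `0 ≤ c`; `ρ₁, ρ₂, ρ₄` arbitrary reals.
[cite: Balaban1982Higgs1, (3.24) p.616] -/
theorem errTerm_pFun_le {S ρ₃ b₀ p₀ σ c κ : ℝ} (ρ₁ ρ₂ ρ₄ : ℝ) (t : ℕ) (hS : 0 ≤ S) (hρ₃ : 0 < ρ₃) (hb₀ : 0 < b₀)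
    (hp₀ : 2 / 3 < p₀) (hσ : 0 < σ) (hc : 0 ≤ c) (hκ : 0 < κ) (hκσ : κ < σ * (t + 1)) :
    ∃ η₀ C : ℝ, 0 < η₀ ∧ η₀ ≤ 1 ∧ 0 ≤ C ∧ ∀ η A : ℝ, 0 < η → η ≤ η₀ → 0 ≤ A → A ≤ c * η ^ σ →
      errTerm S ρ₁ ρ₂ ρ₃ ρ₄ A (B10.pFun b₀ p₀ η) t ≤ C * η ^ κ := by
  -- constants
  have ht1 : (0 : ℝ) < (t : ℝ) + 1 := by positivity
  set δ₁ : ℝ := σ - κ / (t + 1) with hδ₁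
  have hδ₁pos : 0 < δ₁ := by
    rw [hδ₁, sub_pos, div_lt_iff₀ ht1]
    exact hκσ
  obtain ⟨K₁, hK₁pos, hK₁⟩ := exists_one_add_log_inv_rpow_le (p₀ * ρ₁) hδ₁pos
  obtain ⟨K₃, hK₃pos, hK₃⟩ := exists_one_add_log_inv_rpow_le (p₀ * ρ₃) hσ
  have ha : 0 < 3 / 2 * p₀ - 1 := by linarith
  obtain ⟨η₁, hη₁pos, hη₁le, hη₁⟩ := exists_le_one_add_log_inv_rpow ha (κ / (ρ₃ * b₀ ^ (3 / 2 : ℝ)))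
  set G : ℝ := c * b₀ ^ ρ₃ * K₃ with hG
  have hGnonneg : 0 ≤ G := by positivity
  set E₂ : ℝ := Real.exp (|ρ₂| * G) with hE₂
  set E₄ : ℝ := Real.exp (|ρ₄| * G) with hE₄
  set M₁ : ℝ := c * b₀ ^ ρ₁ * K₁ * E₂ with hM₁
  have hM₁nonneg : 0 ≤ M₁ := by positivity
  refine ⟨η₁, S * (M₁ ^ (t + 1) + E₄), hη₁pos, hη₁le, by positivity, ?_⟩
  intro η A hη hηη₁ hA hAc
  have hη1 : η ≤ 1 := hηη₁.trans hη₁le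
  have hb03 : 0 < b₀ ^ (3 / 2 : ℝ) := Real.rpow_pos_of_pos hb₀ _
  set ℓ : ℝ := 1 + Real.log η⁻¹ with hℓ
  have hℓ1 : 1 ≤ ℓ := one_le_one_add_log_inv hη hη1
  have hℓpos : 0 < ℓ := lt_of_lt_of_le zero_lt_one hℓ1
  set b : ℝ := B10.pFun b₀ p₀ η with hbdef
  have hbpos : 0 < b := pFun_pos_of_le_one hb₀ hη hη1
  have hbρ : ∀ ρ : ℝ, b ^ ρ = b₀ ^ ρ * ℓ ^ (p₀ * ρ) := fun ρ => pFun_rpow_eq hb₀ hη hη1 ρ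
  -- the cancellation `η^σ·η^{−σ} = 1` and the splitting `η^σ·η^{−δ₁} = η^{κ/(t+1)}`
  have hcancel : η ^ σ * η ^ (-σ) = 1 := by
    rw [Real.rpow_neg hη.le, mul_inv_cancel₀ (Real.rpow_pos_of_pos hη σ).ne']
  have hsplit : η ^ σ * η ^ (-δ₁) = η ^ (κ / (t + 1)) := by
    rw [← Real.rpow_add hη]
    congr 1
    rw [hδ₁]
    ring
  -- (a) `A·b^{ρ₃} ≤ G`
  have hAb3 : A * b ^ ρ₃ ≤ G := by
    rw [hbρ ρ₃]
    calc A * (b₀ ^ ρ₃ * ℓ ^ (p₀ * ρ₃)) ≤ (c * η ^ σ) * (b₀ ^ ρ₃ * (K₃ * η ^ (-σ))) :=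
          mul_le_mul hAc (mul_le_mul_of_nonneg_left (hK₃ η hη hη1) (Real.rpow_nonneg hb₀.le _))
            (by positivity) (by positivity)
      _ = c * b₀ ^ ρ₃ * K₃ * (η ^ σ * η ^ (-σ)) := by ring
      _ = G := by rw [hcancel, mul_one]
  have hAb3nonneg : 0 ≤ A * b ^ ρ₃ := mul_nonneg hA (Real.rpow_nonneg hbpos.le _)
  -- (b) the two exponential factors are bounded
  have hexp2 : Real.exp (ρ₂ * A * b ^ ρ₃) ≤ E₂ := by
    refine Real.exp_le_exp.mpr ?_
    calc ρ₂ * A * b ^ ρ₃ = ρ₂ * (A * b ^ ρ₃) := by ring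
      _ ≤ |ρ₂| * (A * b ^ ρ₃) := mul_le_mul_of_nonneg_right (le_abs_self _) hAb3nonneg
      _ ≤ |ρ₂| * G := mul_le_mul_of_nonneg_left hAb3 (abs_nonneg _)
  have hexp4 : Real.exp (ρ₄ * A * b ^ ρ₃) ≤ E₄ := by
    refine Real.exp_le_exp.mpr ?_
    calc ρ₄ * A * b ^ ρ₃ = ρ₄ * (A * b ^ ρ₃) := by ring
      _ ≤ |ρ₄| * (A * b ^ ρ₃) := mul_le_mul_of_nonneg_right (le_abs_self _) hAb3nonneg
      _ ≤ |ρ₄| * G := mul_le_mul_of_nonneg_left hAb3 (abs_nonneg _)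
  -- (c) the `(t+1)`-st power term
  have hT1nonneg : 0 ≤ A * b ^ ρ₁ * Real.exp (ρ₂ * A * b ^ ρ₃) :=
    mul_nonneg (mul_nonneg hA (Real.rpow_nonneg hbpos.le _)) (Real.exp_pos _).le
  have hT1 : A * b ^ ρ₁ * Real.exp (ρ₂ * A * b ^ ρ₃) ≤ M₁ * η ^ (κ / (t + 1)) := by
    rw [hbρ ρ₁]
    calc A * (b₀ ^ ρ₁ * ℓ ^ (p₀ * ρ₁)) * Real.exp (ρ₂ * A * b ^ ρ₃)
        ≤ (c * η ^ σ) * (b₀ ^ ρ₁ * (K₁ * η ^ (-δ₁))) * E₂ :=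
          mul_le_mul (mul_le_mul hAc (mul_le_mul_of_nonneg_left (hK₁ η hη hη1) (Real.rpow_nonneg hb₀.le _))
            (by positivity) (by positivity)) hexp2 (Real.exp_pos _).le (by positivity)
      _ = c * b₀ ^ ρ₁ * K₁ * E₂ * (η ^ σ * η ^ (-δ₁)) := by ring
      _ = M₁ * η ^ (κ / (t + 1)) := by rw [hsplit]
  have hpow : (A * b ^ ρ₁ * Real.exp (ρ₂ * A * b ^ ρ₃)) ^ (t + 1) ≤ M₁ ^ (t + 1) * η ^ κ := by
    calc (A * b ^ ρ₁ * Real.exp (ρ₂ * A * b ^ ρ₃)) ^ (t + 1) ≤ (M₁ * η ^ (κ / (t + 1))) ^ (t + 1) :=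
          pow_le_pow_left₀ hT1nonneg hT1 (t + 1)
      _ = M₁ ^ (t + 1) * (η ^ (κ / (t + 1))) ^ (t + 1) := mul_pow _ _ _
      _ = M₁ ^ (t + 1) * η ^ κ := by
          congr 1
          rw [← Real.rpow_natCast, ← Real.rpow_mul hη.le]
          congr 1
          push_cast
          field_simp
  -- (d) the large-field term `e^{−ρ₃b^{3/2}} ≤ η^κ`
  have hlarge : Real.exp (-(ρ₃ * b ^ (3 / 2 : ℝ))) ≤ η ^ κ := by
    refine exp_neg_le_rpow hη hκ.le ?_
    have h32 : b ^ (3 / 2 : ℝ) = b₀ ^ (3 / 2 : ℝ) * (ℓ ^ (3 / 2 * p₀ - 1) * ℓ) := by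
      rw [hbρ (3 / 2 : ℝ), ← Real.rpow_add_one hℓpos.ne']
      congr 1
      congr 1
      ring
    have hM : κ / (ρ₃ * b₀ ^ (3 / 2 : ℝ)) ≤ ℓ ^ (3 / 2 * p₀ - 1) := hη₁ η hη hηη₁
    have hM' : κ ≤ ρ₃ * b₀ ^ (3 / 2 : ℝ) * ℓ ^ (3 / 2 * p₀ - 1) := by
      have := mul_le_mul_of_nonneg_left hM (mul_pos hρ₃ hb03).le
      rwa [mul_div_cancel₀ _ (mul_pos hρ₃ hb03).ne'] at this
    have hM'' : κ * ℓ ≤ ρ₃ * b₀ ^ (3 / 2 : ℝ) * ℓ ^ (3 / 2 * p₀ - 1) * ℓ :=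
      mul_le_mul_of_nonneg_right hM' hℓpos.le
    rw [h32]
    linarith
  have hT2 : Real.exp (-(ρ₃ * b ^ (3 / 2 : ℝ))) * Real.exp (ρ₄ * A * b ^ ρ₃) ≤ η ^ κ * E₄ :=
    mul_le_mul hlarge hexp4 (Real.exp_pos _).le (Real.rpow_nonneg hη.le _)
  -- (e) assemble
  unfold errTerm
  calc S * ((A * b ^ ρ₁ * Real.exp (ρ₂ * A * b ^ ρ₃)) ^ (t + 1) +
          Real.exp (-(ρ₃ * b ^ (3 / 2 : ℝ))) * Real.exp (ρ₄ * A * b ^ ρ₃))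
      ≤ S * (M₁ ^ (t + 1) * η ^ κ + η ^ κ * E₄) := mul_le_mul_of_nonneg_left (add_le_add hpow hT2) hS
    _ = S * (M₁ ^ (t + 1) + E₄) * η ^ κ := by ring

/-- **«κ > d for n sufficiently large, e.g. n > 6» (B1 p. 616), d = 3, certified**: with the coefficients of order `ε^{1/2}`
(`η = ε`, `σ = 1/2`) and the truncation `n̄ = t = 6` of (3.24), the printed error per unit volume is `O(ε^{13/4})`, and
`13/4 > 3 = d`.  (For [Balaban1985UV3]'s «up to the sixth order (or higher) in g₀», p. 261, read `η = g_k`, `σ = 1` in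
`errTerm_pFun_le`: every `κ < 7`, i.e. `O(g_k^{6+2κ₀}) = O((Lᵏε)^{3+κ₀})` for every `κ₀ < 1/2`, cf. `seventh_order_threshold_le`.)
[cite: Balaban1982Higgs1, (3.24) p.616] -/
theorem errTerm_pFun_le_seven {S ρ₃ b₀ p₀ c : ℝ} (ρ₁ ρ₂ ρ₄ : ℝ) (hS : 0 ≤ S) (hρ₃ : 0 < ρ₃) (hb₀ : 0 < b₀)
    (hp₀ : 2 / 3 < p₀) (hc : 0 ≤ c) :
    ∃ η₀ C : ℝ, 0 < η₀ ∧ η₀ ≤ 1 ∧ 0 ≤ C ∧ ∀ η A : ℝ, 0 < η → η ≤ η₀ → 0 ≤ A → A ≤ c * η ^ (1 / 2 : ℝ) →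
      errTerm S ρ₁ ρ₂ ρ₃ ρ₄ A (B10.pFun b₀ p₀ η) 6 ≤ C * η ^ (13 / 4 : ℝ) :=
  errTerm_pFun_le ρ₁ ρ₂ ρ₄ 6 hS hρ₃ hb₀ hp₀ (by norm_num) hc (by norm_num) (by norm_num)

/-- The d = 2 companion: `σ = 1/2`, truncation `t = 4` ⇒ `O(η^{9/4})` per unit volume, `9/4 > 2 = d` (B1 treats
`d = 2, 3`). [cite: Balaban1982Higgs1, (3.24) p.616] -/
theorem errTerm_pFun_le_five {S ρ₃ b₀ p₀ c : ℝ} (ρ₁ ρ₂ ρ₄ : ℝ) (hS : 0 ≤ S) (hρ₃ : 0 < ρ₃) (hb₀ : 0 < b₀)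
    (hp₀ : 2 / 3 < p₀) (hc : 0 ≤ c) :
    ∃ η₀ C : ℝ, 0 < η₀ ∧ η₀ ≤ 1 ∧ 0 ≤ C ∧ ∀ η A : ℝ, 0 < η → η ≤ η₀ → 0 ≤ A → A ≤ c * η ^ (1 / 2 : ℝ) →
      errTerm S ρ₁ ρ₂ ρ₃ ρ₄ A (B10.pFun b₀ p₀ η) 4 ≤ C * η ^ (9 / 4 : ℝ) :=
  errTerm_pFun_le ρ₁ ρ₂ ρ₄ 4 hS hρ₃ hb₀ hp₀ (by norm_num) hc (by norm_num) (by norm_num)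

/-! ## §4  Two facts about the typed objects of [2]: `A ≡ sup|coefficient| ≥ 0`, and the log-sandwich (4.6)∅ ∧ (4.7) -/

variable {d : ℕ}

/-- The index range of (4.5) is finite, so the set of the `|coefficients|` (with `0` adjoined) is bounded above.
[cite: BenfattoEtAl1978, (4.5) p.152] -/
theorem bddAbove_coefSet (s D : ℕ) (a : Coef d) (J : Finset (Fin d → ℤ)) :
    BddAbove (insert 0 {r : ℝ | ∃ p ∈ Finset.Icc 1 s, ∃ Δ : Fin p → J, ∃ n ∈ admissible p D,
      r = |a p (fun i => (Δ i : Fin d → ℤ)) n|}) := by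
  refine BddAbove.insert 0 (Set.Finite.bddAbove ?_)
  refine Set.Finite.subset ((Finset.Icc 1 s).finite_toSet.biUnion fun p _ =>
    Set.finite_range fun x : (Fin p → J) × (admissible p D) =>
      |a p (fun i => (x.1 i : Fin d → ℤ)) (x.2 : Fin p → ℕ)|) ?_
  rintro r ⟨p, hp, Δ, n, hn, rfl⟩
  simp only [Set.mem_iUnion, Set.mem_range, Finset.mem_coe]
  exact ⟨p, hp, ⟨Δ, ⟨n, hn⟩⟩, rfl⟩

/-- **`A ≡ sup|A^{n₁…n_p}_{Δ₁…Δ_p}| ≥ 0`** (the API a consumer of the coefficient bound needs). [cite: BenfattoEtAl1978, (4.5) p.152] -/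
theorem coefSup_nonneg (s D : ℕ) (a : Coef d) (J : Finset (Fin d → ℤ)) : 0 ≤ coefSup s D a J :=
  le_csSup (bddAbove_coefSet s D a J) (Set.mem_insert 0 _)

/-- Every coefficient in the index range of (4.5) is bounded by `A`. [cite: BenfattoEtAl1978, (4.5) p.152] -/
theorem abs_coef_le_coefSup (s D : ℕ) (a : Coef d) (J : Finset (Fin d → ℤ)) {p : ℕ} (hp : p ∈ Finset.Icc 1 s)
    (Δ : Fin p → J) {n : Fin p → ℕ} (hn : n ∈ admissible p D) :
    |a p (fun i => (Δ i : Fin d → ℤ)) n| ≤ coefSup s D a J :=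
  le_csSup (bddAbove_coefSet s D a J) (Set.mem_insert_of_mem 0 ⟨p, hp, Δ, n, hn, rfl⟩)

/-- **The log-sandwich of (4.6) at `C = ∅` and (4.7)** (where `P̄ = P̂₀`, `condField_empty`): the cut-off exponential moment is
positive and `|log ∫Π_Δχ̂_Δ e^{H_J} dP̂₀ − Σ_{k=1}^{t} ℰ̂₀^T(H_J; k)/k!| ≦ |I|·S(…)` — (3.24) of [Balaban1982Higgs1] in the OUTPUT form,
for one choice of everything. [cite: BenfattoEtAl1978, (4.6)–(4.7) p.152] -/
theorem abs_log_integral_sub_cumulantSum_le {α β : ℝ} {t D s : ℕ} {ϰ S ρ₁ ρ₂ ρ₃ ρ₄ b : ℝ} {I J : Finset (Fin d → ℤ)}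
    {a : Coef d}
    (h46 : ∀ (C : Finset (Fin d → ℤ)) (zbar : (Fin d → ℤ) → ℝ), (∀ x ∈ C, ∀ y ∈ J, b ^ 3 ≤ cubeDist x y) →
      Ineq46 d α β t D s ϰ S ρ₁ ρ₂ ρ₃ ρ₄ b I J C a zbar)
    (h47 : Ineq47 d α β t D s ϰ S ρ₁ ρ₂ ρ₃ ρ₄ b I J a) :
    0 < ∫ z, cutoffBoltzmann (hamiltonian s D ϰ a J) I b z ∂P0 d α β ∧
      |Real.log (∫ z, cutoffBoltzmann (hamiltonian s D ϰ a J) I b z ∂P0 d α β) -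
          cumulantSum (P0 d α β) (hamiltonian s D ϰ a J) t| ≤
        (I.card : ℝ) * errTerm S ρ₁ ρ₂ ρ₃ ρ₄ (coefSup s D a J) b t := by
  have hup := h46 ∅ (fun _ => 0) fun x hx => absurd hx (Finset.notMem_empty _)
  rw [Ineq46, condField_empty] at hup
  have hlow : _ ≤ _ := h47
  have hpos : 0 < ∫ z, cutoffBoltzmann (hamiltonian s D ϰ a J) I b z ∂P0 d α β :=
    lt_of_lt_of_le (Real.exp_pos _) hlow
  refine ⟨hpos, abs_sub_le_iff.mpr ⟨?_, ?_⟩⟩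
  · have := (Real.log_le_iff_le_exp hpos).mpr hup
    linarith
  · have := (Real.le_log_iff_exp_le hpos).mpr hlow
    linarith

/-! ## §5  B1 (3.24) IN BENFATTO'S CURRENCY: the Lemma of p. 152 with explicit constants ⇒ `O(η^κ)|I|` -/

/-- What the typed named fact hands a consumer: `BasicLemma d α β` gives, for each `(t, D, ϰ > 0)`, SOME constants
`b*, S, ρ₁, ρ₂, ρ₃, ρ₄` satisfying (4.6) ∧ (4.7) — exactly the hypothesis `h` of `eq324_of_basicLemma_consts` below, but with NO
sign information (whence that theorem's separate hypotheses `0 ≤ S`, `0 < ρ₃`). [cite: BenfattoEtAl1978, Lemma p.152 (4.5)–(4.7)] -/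
theorem exists_consts_of_basicLemma {α β : ℝ} (h : BasicLemma d α β) (t D : ℕ) {ϰ : ℝ} (hϰ : 0 < ϰ) :
    ∃ bstar S ρ₁ ρ₂ ρ₃ ρ₄ : ℝ, ∀ (s : ℕ) (b : ℝ), bstar < b → ∀ (I J : Finset (Fin d → ℤ)), I.Nonempty → J ⊆ I →
      ∀ a : Coef d,
        (∀ (C : Finset (Fin d → ℤ)) (zbar : (Fin d → ℤ) → ℝ), (∀ x ∈ C, ∀ y ∈ J, b ^ 3 ≤ cubeDist x y) →
            Ineq46 d α β t D s ϰ S ρ₁ ρ₂ ρ₃ ρ₄ b I J C a zbar) ∧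
          Ineq47 d α β t D s ϰ S ρ₁ ρ₂ ρ₃ ρ₄ b I J a := by
  obtain ⟨bstar, hb⟩ := h
  obtain ⟨S, ρ₁, ρ₂, ρ₃, ρ₄, hS⟩ := hb t D ϰ hϰ
  exact ⟨bstar, S, ρ₁, ρ₂, ρ₃, ρ₄, hS⟩

/-- **[Balaban1982Higgs1] (3.24) p. 616 from «the lemma formulated on p. 152» of [2], AS A THEOREM ABOUT [2]'s OBJECTS.**
Suppose the constants `b*, S, ρ₁, ρ₂, ρ₃, ρ₄` satisfy (4.6) and (4.7) for the truncation order `t`, degree `D` and decay `ϰ` (the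
body of `BasicLemma d α β` for ONE choice of constants) with the signs `0 ≤ S`, `0 < ρ₃` that print's Remark 4 presupposes
(`le_errTerm_of_rho3_nonpos`).  Then for coefficients `A ≡ sup|coeff| ≤ c·η^σ` and the field threshold `b = p(η) = b₀(1 + log η⁻¹)^{p₀}`
(`p₀ > 2/3`), for every exponent `0 < κ < σ(t+1)` there are `η₀ ∈ (0, 1]` and `C ≥ 0` such that for all `η ∈ (0, η₀]`, all `s`,
all nonempty `I ⊇ J` and all coefficient families:
`|log ∫Π_Δχ̂_Δ e^{H_J} dP̂₀ − Σ_{k=1}^{t} ℰ̂₀^T(H_J; k)/k!| ≦ C·η^κ·|I|` — B1's «⟨χ exp(V)⟩ = exp[⟨V⟩ + … + (1/n̄!)⟨V^n̄⟩ᵀ + O(εᵏ)|T₁|]»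
with `n̄ = t`, in the currency of [2] (unconditional Gaussian truncated expectations, thresholds growing away from `I`).  Honest
scope: a theorem about [2]'s free field (1.1) and Hamiltonians (4.5); the identification of B1's / B10's fluctuation integrals
with instances of it is B1's sentence «all the assumptions are satisfied», NOT certified here.
[cite: Balaban1982Higgs1, (3.24) p.616] -/
theorem eq324_of_basicLemma_consts {α β : ℝ} {t D : ℕ} {ϰ bstar S ρ₁ ρ₂ ρ₃ ρ₄ b₀ p₀ σ c κ : ℝ}
    (h : ∀ (s : ℕ) (b : ℝ), bstar < b → ∀ (I J : Finset (Fin d → ℤ)), I.Nonempty → J ⊆ I → ∀ a : Coef d,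
      (∀ (C : Finset (Fin d → ℤ)) (zbar : (Fin d → ℤ) → ℝ), (∀ x ∈ C, ∀ y ∈ J, b ^ 3 ≤ cubeDist x y) →
          Ineq46 d α β t D s ϰ S ρ₁ ρ₂ ρ₃ ρ₄ b I J C a zbar) ∧
        Ineq47 d α β t D s ϰ S ρ₁ ρ₂ ρ₃ ρ₄ b I J a)
    (hS : 0 ≤ S) (hρ₃ : 0 < ρ₃) (hb₀ : 0 < b₀) (hp₀ : 2 / 3 < p₀) (hσ : 0 < σ) (hc : 0 ≤ c) (hκ : 0 < κ)
    (hκσ : κ < σ * (t + 1)) :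
    ∃ η₀ C : ℝ, 0 < η₀ ∧ η₀ ≤ 1 ∧ 0 ≤ C ∧ ∀ η : ℝ, 0 < η → η ≤ η₀ →
      ∀ (s : ℕ) (I J : Finset (Fin d → ℤ)) (a : Coef d), I.Nonempty → J ⊆ I → coefSup s D a J ≤ c * η ^ σ →
        0 < ∫ z, cutoffBoltzmann (hamiltonian s D ϰ a J) I (B10.pFun b₀ p₀ η) z ∂P0 d α β ∧
          |Real.log (∫ z, cutoffBoltzmann (hamiltonian s D ϰ a J) I (B10.pFun b₀ p₀ η) z ∂P0 d α β) -
              cumulantSum (P0 d α β) (hamiltonian s D ϰ a J) t| ≤ C * η ^ κ * I.card := by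
  obtain ⟨η₁, C, hη₁pos, hη₁le, hC, hE⟩ := errTerm_pFun_le ρ₁ ρ₂ ρ₄ t hS hρ₃ hb₀ hp₀ hσ hc hκ hκσ
  obtain ⟨η₂, hη₂pos, hη₂le, hη₂⟩ :=
    exists_le_one_add_log_inv_rpow (lt_trans (by norm_num) hp₀ : 0 < p₀) ((|bstar| + 1) / b₀)
  refine ⟨min η₁ η₂, C, lt_min hη₁pos hη₂pos, (min_le_left _ _).trans hη₁le, hC, ?_⟩
  intro η hη hηle s I J a hI hJI hA
  have hηη₁ : η ≤ η₁ := hηle.trans (min_le_left _ _)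
  have hηη₂ : η ≤ η₂ := hηle.trans (min_le_right _ _)
  -- the threshold exceeds `b*`
  have hb : bstar < B10.pFun b₀ p₀ η := by
    have hM := hη₂ η hη hηη₂
    have h1 : |bstar| + 1 ≤ B10.pFun b₀ p₀ η := by
      unfold B10.pFun
      have := mul_le_mul_of_nonneg_left hM hb₀.le
      rwa [mul_div_cancel₀ _ hb₀.ne'] at this
    linarith [le_abs_self bstar]
  obtain ⟨h46, h47⟩ := h s (B10.pFun b₀ p₀ η) hb I J hI hJI a
  obtain ⟨hpos, hsand⟩ := abs_log_integral_sub_cumulantSum_le h46 h47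
  refine ⟨hpos, hsand.trans ?_⟩
  have herr := hE η (coefSup s D a J) hη hηη₁ (coefSup_nonneg s D a J) hA
  calc (I.card : ℝ) * errTerm S ρ₁ ρ₂ ρ₃ ρ₄ (coefSup s D a J) (B10.pFun b₀ p₀ η) t ≤ (I.card : ℝ) * (C * η ^ κ) :=
        mul_le_mul_of_nonneg_left herr (Nat.cast_nonneg _)
    _ = C * η ^ κ * I.card := by ring

/-- **The case B1 names («e.g. n > 6», d = 3)**: coefficients of order `ε^{1/2}` (`σ = 1/2`), truncation `n̄ = t = 6` ⇒ the
remainder is `O(η^{13/4})|I|` with `13/4 > 3 = d`. [cite: Balaban1982Higgs1, (3.24) p.616] -/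
theorem eq324_of_basicLemma_consts_seven {α β : ℝ} {D : ℕ} {ϰ bstar S ρ₁ ρ₂ ρ₃ ρ₄ b₀ p₀ c : ℝ}
    (h : ∀ (s : ℕ) (b : ℝ), bstar < b → ∀ (I J : Finset (Fin d → ℤ)), I.Nonempty → J ⊆ I → ∀ a : Coef d,
      (∀ (C : Finset (Fin d → ℤ)) (zbar : (Fin d → ℤ) → ℝ), (∀ x ∈ C, ∀ y ∈ J, b ^ 3 ≤ cubeDist x y) →
          Ineq46 d α β 6 D s ϰ S ρ₁ ρ₂ ρ₃ ρ₄ b I J C a zbar) ∧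
        Ineq47 d α β 6 D s ϰ S ρ₁ ρ₂ ρ₃ ρ₄ b I J a)
    (hS : 0 ≤ S) (hρ₃ : 0 < ρ₃) (hb₀ : 0 < b₀) (hp₀ : 2 / 3 < p₀) (hc : 0 ≤ c) :
    ∃ η₀ C : ℝ, 0 < η₀ ∧ η₀ ≤ 1 ∧ 0 ≤ C ∧ ∀ η : ℝ, 0 < η → η ≤ η₀ →
      ∀ (s : ℕ) (I J : Finset (Fin d → ℤ)) (a : Coef d), I.Nonempty → J ⊆ I →
        coefSup s D a J ≤ c * η ^ (1 / 2 : ℝ) →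
        0 < ∫ z, cutoffBoltzmann (hamiltonian s D ϰ a J) I (B10.pFun b₀ p₀ η) z ∂P0 d α β ∧
          |Real.log (∫ z, cutoffBoltzmann (hamiltonian s D ϰ a J) I (B10.pFun b₀ p₀ η) z ∂P0 d α β) -
              cumulantSum (P0 d α β) (hamiltonian s D ϰ a J) 6| ≤ C * η ^ (13 / 4 : ℝ) * I.card :=
  eq324_of_basicLemma_consts h hS hρ₃ hb₀ hp₀ (by norm_num) hc (by norm_num) (by norm_num)

/-! ## §6  Appendix A (A.1)–(A.2) in the same currency: the small-field VOLUME `log P̂₀(Πχ̂ᵇ) ≥ −|I|·k₁·η^κ` -/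

/-- **The small-field volume of the free field in `η`-currency.**  If (A.1)–(A.2) hold with explicit constants `b̄`, `k₁ ≥ 0`,
`k₂ > 0` (the shape `F_b ≥ exp[−|I|k₁e^{−k₂b²}]`, `b > b̄`), then with the threshold `b = p(η) = b₀(1 + log η⁻¹)^{p₀}`, `p₀ > 1/2`,
for every `κ > 0` there is `η₀ ∈ (0, 1]` with `P̂₀(Π_Δχ̂_Δ) > 0` and `log P̂₀(Π_Δχ̂_Δ) ≥ −|I|·k₁·η^κ` for all `η ∈ (0, η₀]` and all
nonempty `I` — the `−W`, `W = O(εᵏ)|T₁|`, small-field-volume input of the LOWER half of (3.24) (cf. the hypothesis shape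
`B10Eq24Cumulant.FluctuationModel.SmallFieldVolume`).  `e^{−k₂b²}` beats every power of `η` because `2p₀ > 1`.
[cite: BenfattoEtAl1978, Appendix A Lemma (A.1)–(A.2) p.161] -/
theorem log_smallFieldSet_ge_of_appendixA_consts {α β : ℝ} {bbar k₁ k₂ b₀ p₀ κ : ℝ}
    (h : ∀ b : ℝ, bbar < b → ∀ I : Finset (Fin d → ℤ), I.Nonempty →
      Real.exp (-((I.card : ℝ) * (k₁ * Real.exp (-(k₂ * b ^ 2))))) ≤ (P0 d α β).real (smallFieldSet I b))
    (hk₁ : 0 ≤ k₁) (hk₂ : 0 < k₂) (hb₀ : 0 < b₀) (hp₀ : 1 / 2 < p₀) (hκ : 0 < κ) :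
    ∃ η₀ : ℝ, 0 < η₀ ∧ η₀ ≤ 1 ∧ ∀ η : ℝ, 0 < η → η ≤ η₀ → ∀ I : Finset (Fin d → ℤ), I.Nonempty →
      0 < (P0 d α β).real (smallFieldSet I (B10.pFun b₀ p₀ η)) ∧
        -((I.card : ℝ) * k₁ * η ^ κ) ≤ Real.log ((P0 d α β).real (smallFieldSet I (B10.pFun b₀ p₀ η))) := by
  have hp₀pos : 0 < p₀ := lt_trans (by norm_num) hp₀
  have ha : 0 < 2 * p₀ - 1 := by linarith
  obtain ⟨η₁, hη₁pos, hη₁le, hη₁⟩ := exists_le_one_add_log_inv_rpow ha (κ / (k₂ * b₀ ^ 2))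
  obtain ⟨η₂, hη₂pos, hη₂le, hη₂⟩ := exists_le_one_add_log_inv_rpow hp₀pos ((|bbar| + 1) / b₀)
  refine ⟨min η₁ η₂, lt_min hη₁pos hη₂pos, (min_le_left _ _).trans hη₁le, ?_⟩
  intro η hη hηle I hI
  have hηη₁ : η ≤ η₁ := hηle.trans (min_le_left _ _)
  have hηη₂ : η ≤ η₂ := hηle.trans (min_le_right _ _)
  have hη1 : η ≤ 1 := hηη₁.trans hη₁le
  set ℓ : ℝ := 1 + Real.log η⁻¹ with hℓ
  have hℓ1 : 1 ≤ ℓ := one_le_one_add_log_inv hη hη1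
  have hℓpos : 0 < ℓ := lt_of_lt_of_le zero_lt_one hℓ1
  set b : ℝ := B10.pFun b₀ p₀ η with hbdef
  -- the threshold exceeds `b̄`
  have hb : bbar < b := by
    have hM := hη₂ η hη hηη₂
    have h1 : |bbar| + 1 ≤ b := by
      rw [hbdef]
      unfold B10.pFun
      have := mul_le_mul_of_nonneg_left hM hb₀.le
      rwa [mul_div_cancel₀ _ hb₀.ne'] at this
    linarith [le_abs_self bbar]
  -- `e^{−k₂b²} ≤ η^κ`
  have hsmall : Real.exp (-(k₂ * b ^ 2)) ≤ η ^ κ := by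
    refine exp_neg_le_rpow hη hκ.le ?_
    have hb2 : b ^ 2 = b₀ ^ 2 * (ℓ ^ (2 * p₀ - 1) * ℓ) := by
      have e1 : b ^ 2 = b₀ ^ 2 * ℓ ^ (2 * p₀) := pFun_sq_eq b₀ hη hη1
      rw [e1, ← Real.rpow_add_one hℓpos.ne']
      congr 1
      congr 1
      ring
    have hk : 0 < k₂ * b₀ ^ 2 := mul_pos hk₂ (pow_pos hb₀ 2)
    have hM : κ / (k₂ * b₀ ^ 2) ≤ ℓ ^ (2 * p₀ - 1) := hη₁ η hη hηη₁
    have hM' : κ ≤ k₂ * b₀ ^ 2 * ℓ ^ (2 * p₀ - 1) := by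
      have := mul_le_mul_of_nonneg_left hM hk.le
      rwa [mul_div_cancel₀ _ hk.ne'] at this
    have hM'' : κ * ℓ ≤ k₂ * b₀ ^ 2 * ℓ ^ (2 * p₀ - 1) * ℓ := mul_le_mul_of_nonneg_right hM' hℓpos.le
    rw [hb2]
    linarith
  -- assemble
  have hA := h b hb I hI
  have hexp : Real.exp (-((I.card : ℝ) * k₁ * η ^ κ)) ≤
      Real.exp (-((I.card : ℝ) * (k₁ * Real.exp (-(k₂ * b ^ 2))))) := by
    refine Real.exp_le_exp.mpr ?_
    have : (I.card : ℝ) * (k₁ * Real.exp (-(k₂ * b ^ 2))) ≤ (I.card : ℝ) * k₁ * η ^ κ := by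
      rw [← mul_assoc]
      exact mul_le_mul_of_nonneg_left hsmall (by positivity)
    linarith
  have hle := hexp.trans hA
  have hpos : 0 < (P0 d α β).real (smallFieldSet I b) := lt_of_lt_of_le (Real.exp_pos _) hle
  exact ⟨hpos, (Real.le_log_iff_exp_le hpos).mpr hle⟩

/-- **UNCONDITIONAL: the small-field volume of [2]'s free field (1.1) at B1's threshold.**  For every `d`, `α, β > 0`,
`b₀ > 0`, `p₀ > 1/2` and `κ > 0` there is `η₀ ∈ (0, 1]` such that for all `η ∈ (0, η₀]` and all nonempty regions `I`:
`P̂₀(|z_Δ| ≦ p(η)(1 + d(Δ, I)) ∀Δ) > 0` and `log P̂₀(…) ≧ −|I|·4·8^d·η^κ` — Appendix A (A.1)–(A.2) (PROVED in the tree: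
`B1Eq324BenfattoAppendixA.appendixA_explicit`, constants `k₁ = 4·8^d`, `k₂ = 1/(2C)`, `C = |E z_Δ²| + 1`, `b̄ = max 2 2C`) composed
with `log_smallFieldSet_ge_of_appendixA_consts`.  No hypothesis beyond the parameters' signs.
[cite: BenfattoEtAl1978, Appendix A Lemma (A.1)–(A.2) p.161] -/
theorem log_smallFieldSet_P0_ge {α β b₀ p₀ κ : ℝ} (hα : 0 < α) (hβ : 0 < β) (hb₀ : 0 < b₀) (hp₀ : 1 / 2 < p₀)
    (hκ : 0 < κ) :
    ∃ η₀ : ℝ, 0 < η₀ ∧ η₀ ≤ 1 ∧ ∀ η : ℝ, 0 < η → η ≤ η₀ → ∀ I : Finset (Fin d → ℤ), I.Nonempty →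
      0 < (P0 d α β).real (smallFieldSet I (B10.pFun b₀ p₀ η)) ∧
        -((I.card : ℝ) * (4 * 8 ^ d) * η ^ κ) ≤ Real.log ((P0 d α β).real (smallFieldSet I (B10.pFun b₀ p₀ η))) := by
  set C : ℝ := |freeCov d α β 0 0| + 1 with hC_def
  have hC : 0 < C := by positivity
  have hvar : freeCov d α β 0 0 ≤ C := (le_abs_self _).trans (by linarith)
  have h : ∀ b : ℝ, max 2 (2 * C) < b → ∀ I : Finset (Fin d → ℤ), I.Nonempty →
      Real.exp (-((I.card : ℝ) * ((4 * 8 ^ d) * Real.exp (-(1 / (2 * C) * b ^ 2))))) ≤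
        (P0 d α β).real (smallFieldSet I b) := by
    intro b hb I hI
    have h2 : 2 < b := lt_of_le_of_lt (le_max_left _ _) hb
    have h2C : 2 * C < b := lt_of_le_of_lt (le_max_right _ _) hb
    have hb0 : 0 < b := by linarith
    have hb4 : 4 * C ≤ b ^ 2 := by nlinarith [mul_pos (sub_pos.2 h2C) hb0, mul_pos hC (sub_pos.2 h2)]
    have key := B1Eq324BenfattoAppendixA.appendixA_explicit hα hβ hC hvar hb0 hb4 hI
    have heq : 1 / (2 * C) * b ^ 2 = b ^ 2 / (2 * C) := by ring
    rw [heq]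
    exact key
  exact log_smallFieldSet_ge_of_appendixA_consts h (by positivity) (by positivity) hb₀ hp₀ hκ

/-! ## §7  The sign of `S` IS forced by (4.7) (v1.1): `P̂₀(Π_Δχ̂_Δ) < 1`, hence `S > 0` -/

open _root_.ProbabilityTheory
open Literature.Probability.LatticeModels (cumulantOf moment_succ_eq_sum_choose_mul_cumulantOf)

/-- The Hamiltonian (4.5) of the zero coefficient family is `0`. [cite: BenfattoEtAl1978, (4.5) p.152] -/
theorem hamiltonian_zero (s D : ℕ) (ϰ : ℝ) (J : Finset (Fin d → ℤ)) :
    hamiltonian s D ϰ (fun _ _ _ => (0 : ℝ)) J = fun _ => 0 := by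
  funext z
  simp [hamiltonian]

/-- `A ≡ sup|coeff| = 0` for the zero coefficient family. [cite: BenfattoEtAl1978, (4.5) p.152] -/
theorem coefSup_zero (s D : ℕ) (J : Finset (Fin d → ℤ)) : coefSup s D (fun _ _ _ => (0 : ℝ)) J = 0 := by
  refine le_antisymm ?_ (coefSup_nonneg s D _ J)
  refine csSup_le ⟨0, Set.mem_insert 0 _⟩ ?_
  rintro r hr
  rcases Set.mem_insert_iff.mp hr with rfl | ⟨p, _, Δ, n, _, rfl⟩
  · exact le_rfl
  · simp

/-- **Cumulants of a moment sequence with vanishing moments vanish**: if `μ 0 = 1` and `μ n = 0` for `n ≥ 1` then every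
cumulant `κ_k`, `k ≥ 1`, is `0` — read off the moment–cumulant recursion `μ_{n+1} = Σ_k C(n,k) κ_{k+1} μ_{n−k}`, whose only
surviving term is `κ_{n+1}·μ_0`. [cite: BenfattoEtAl1978, (2.7) p.147] -/
theorem cumulantOf_eq_zero_of_moments_eq_zero {μ : ℕ → ℝ} (h0 : μ 0 = 1) (h : ∀ n, 1 ≤ n → μ n = 0) {k : ℕ}
    (hk : 1 ≤ k) : cumulantOf μ k = 0 := by
  obtain ⟨n, rfl⟩ : ∃ n, k = n + 1 := ⟨k - 1, by omega⟩
  have hrec := moment_succ_eq_sum_choose_mul_cumulantOf μ h0 n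
  rw [Finset.sum_range_succ, Finset.sum_eq_zero fun i hi => ?_, zero_add, Nat.choose_self, Nat.sub_self, h0,
    h (n + 1) (by omega)] at hrec
  · simpa using hrec.symm
  · rw [h (n - i) (by have := Finset.mem_range.mp hi; omega), mul_zero]

/-- The truncated expectations of the ZERO variable vanish: `Σ_{k=1}^{t} ℰ^T(0; k)/k! = 0` under any probability measure (its
moment sequence is `1, 0, 0, …`). [cite: BenfattoEtAl1978, (2.7) p.147] -/
theorem cumulantSum_zero (μ : Measure ((Fin d → ℤ) → ℝ)) [IsProbabilityMeasure μ] (t : ℕ) :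
    cumulantSum μ (fun _ => 0) t = 0 := by
  unfold cumulantSum
  refine Finset.sum_eq_zero fun k hk => ?_
  have hk1 : 1 ≤ k := (Finset.mem_Icc.mp hk).1
  have hzero : truncatedExp μ (fun _ => (0 : ℝ)) k = 0 := by
    unfold truncatedExp
    refine cumulantOf_eq_zero_of_moments_eq_zero ?_ (fun n hn => ?_) hk1
    · show ∫ _z, (0 : ℝ) ^ 0 ∂μ = 1
      rw [pow_zero, integral_const, probReal_univ, one_smul]
    · show ∫ _z, (0 : ℝ) ^ n ∂μ = 0
      rw [zero_pow (by omega), integral_zero]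
  rw [hzero, zero_div]

/-- The cut-off integral of the zero Hamiltonian is the small-field volume `P̂₀(Π_Δχ̂_Δ)`.
[cite: BenfattoEtAl1978, (4.7) p.152] -/
theorem integral_cutoffBoltzmann_zero (μ : Measure ((Fin d → ℤ) → ℝ)) (I : Finset (Fin d → ℤ)) (b : ℝ) :
    ∫ z, cutoffBoltzmann (fun _ => 0) I b z ∂μ = μ.real (smallFieldSet I b) := by
  unfold cutoffBoltzmann
  simp only [Real.exp_zero]
  rw [integral_indicator (measurableSet_smallFieldSet I b), setIntegral_const, smul_eq_mul, mul_one]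

/-- **The small-field event of [2]'s free field has probability `< 1`** (`α, β > 0`, `I ≠ ∅`, any threshold `b`): already ONE
coordinate `z_Δ`, `Δ ∈ I`, is a non-degenerate centred Gaussian (variance `E z_Δ² = freeCov d α β 0 0 > 0`,
`B1Eq324BenfattoAppendixA.freeCov_zero_zero_pos`), whose law charges `{|y| > τ}` for every `τ`.
[cite: BenfattoEtAl1978, (1.1) p.144] -/
theorem P0_real_smallFieldSet_lt_one {α β : ℝ} (hα : 0 < α) (hβ : 0 < β) {I : Finset (Fin d → ℤ)} (hI : I.Nonempty)
    (b : ℝ) : (P0 d α β).real (smallFieldSet I b) < 1 := by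
  obtain ⟨x₀, -⟩ := hI
  haveI := isProbabilityMeasure_P0 (d := d) hα hβ
  set τ : ℝ := b * (1 + distToRegion I x₀) with hτ
  have hsub : smallFieldSet I b ⊆ {z : (Fin d → ℤ) → ℝ | |z x₀| ≤ τ} := fun z hz => hz x₀
  have hE : MeasurableSet {z : (Fin d → ℤ) → ℝ | |z x₀| ≤ τ} :=
    measurableSet_le (continuous_abs.measurable.comp (measurable_pi_apply x₀)) measurable_const
  -- the one-site marginal is a non-degenerate Gaussian
  have hX : ProbabilityTheory.HasGaussianLaw (fun z : (Fin d → ℤ) → ℝ => z x₀) (P0 d α β) :=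
    (isGaussianProcess_P0 hα hβ).hasGaussianLaw_eval x₀
  have hmap := hX.map_eq_gaussianReal
  have hvar : Var[fun z : (Fin d → ℤ) → ℝ => z x₀; P0 d α β] = freeCov d α β 0 0 := by
    rw [← ProbabilityTheory.covariance_self (measurable_pi_apply x₀).aemeasurable, covariance_eval_P0 hα hβ,
      freeCov_self]
  have hv : (Var[fun z : (Fin d → ℤ) → ℝ => z x₀; P0 d α β]).toNNReal ≠ 0 := by
    rw [hvar]
    exact (Real.toNNReal_pos.mpr (B1Eq324BenfattoAppendixA.freeCov_zero_zero_pos hα hβ)).ne'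
  -- the complement `{|z_{x₀}| > τ}` has positive probability
  have hpos : 0 < (P0 d α β) {z : (Fin d → ℤ) → ℝ | |z x₀| ≤ τ}ᶜ := by
    have hpre : {z : (Fin d → ℤ) → ℝ | |z x₀| ≤ τ}ᶜ = (fun z : (Fin d → ℤ) → ℝ => z x₀) ⁻¹' {y : ℝ | τ < |y|} := by
      ext z
      simp [not_le]
    rw [hpre, ← Measure.map_apply (measurable_pi_apply x₀) (measurableSet_lt measurable_const continuous_abs.measurable),
      hmap]
    have hac := ProbabilityTheory.gaussianReal_absolutelyContinuous' (∫ z, (fun z : (Fin d → ℤ) → ℝ => z x₀) z ∂P0 d α β) hv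
    rw [pos_iff_ne_zero]
    intro hzero
    have hvol : volume (Set.Ioo (|τ| + 1) (|τ| + 2)) = 0 := by
      refine measure_mono_null (fun y hy => ?_) (hac hzero)
      simp only [Set.mem_setOf_eq]
      have h1 : τ ≤ |τ| := le_abs_self τ
      have h2 : |τ| + 1 < y := hy.1
      have h3 : y ≤ |y| := le_abs_self y
      linarith
    rw [Real.volume_Ioo] at hvol
    have : ENNReal.ofReal (|τ| + 2 - (|τ| + 1)) = 1 := by
      rw [show |τ| + 2 - (|τ| + 1) = (1 : ℝ) by ring, ENNReal.ofReal_one]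
    rw [this] at hvol
    exact one_ne_zero hvol
  -- conclude: `P̂₀(E) = 1 − P̂₀(Eᶜ) < 1`
  have hreal : 0 < (P0 d α β).real {z : (Fin d → ℤ) → ℝ | |z x₀| ≤ τ}ᶜ :=
    ENNReal.toReal_pos hpos.ne' (measure_ne_top _ _)
  have hcompl := probReal_compl_eq_one_sub (μ := P0 d α β) hE
  have h1 : (P0 d α β).real {z : (Fin d → ℤ) → ℝ | |z x₀| ≤ τ} < 1 := by linarith
  exact (measureReal_mono hsub).trans_lt h1

/-- **`S > 0` is FORCED**: if (4.7) holds for the ZERO coefficient family (`H_J = 0`, `A = 0`, all cumulants `0`) on a nonempty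
region `I`, then `exp(−|I|·S·e^{−ρ₃b^{3/2}}) ≦ P̂₀(Π_Δχ̂_Δ) < 1`, so `S > 0`.  Together with `le_errTerm_of_rho3_nonpos`: the typed
inequalities DETERMINE the sign of `S` but NOT that of `ρ₃`. [cite: BenfattoEtAl1978, (4.7) p.152] -/
theorem S_pos_of_ineq47_zero {α β : ℝ} (hα : 0 < α) (hβ : 0 < β) {t D s : ℕ} {ϰ S ρ₁ ρ₂ ρ₃ ρ₄ b : ℝ}
    {I J : Finset (Fin d → ℤ)} (hI : I.Nonempty)
    (h47 : Ineq47 d α β t D s ϰ S ρ₁ ρ₂ ρ₃ ρ₄ b I J (fun _ _ _ => 0)) : 0 < S := by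
  haveI := isProbabilityMeasure_P0 (d := d) hα hβ
  have h : Real.exp (cumulantSum (P0 d α β) (hamiltonian s D ϰ (fun _ _ _ => (0 : ℝ)) J) t -
      (I.card : ℝ) * errTerm S ρ₁ ρ₂ ρ₃ ρ₄ (coefSup s D (fun _ _ _ => (0 : ℝ)) J) b t) ≤
      ∫ z, cutoffBoltzmann (hamiltonian s D ϰ (fun _ _ _ => (0 : ℝ)) J) I b z ∂P0 d α β := h47
  rw [hamiltonian_zero, coefSup_zero, cumulantSum_zero, errTerm_zero_A, integral_cutoffBoltzmann_zero] at h
  have hlt := lt_of_le_of_lt h (P0_real_smallFieldSet_lt_one hα hβ hI b)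
  have hneg : 0 - (I.card : ℝ) * (S * Real.exp (-(ρ₃ * b ^ (3 / 2 : ℝ)))) < 0 := Real.exp_lt_one_iff.mp hlt
  have hcard : (0 : ℝ) < I.card := Nat.cast_pos.mpr (Finset.card_pos.mpr hI)
  have hmul : 0 < (I.card : ℝ) * (S * Real.exp (-(ρ₃ * b ^ (3 / 2 : ℝ)))) := by linarith
  have hprod : 0 < S * Real.exp (-(ρ₃ * b ^ (3 / 2 : ℝ))) := pos_of_mul_pos_right hmul hcard.le
  exact pos_of_mul_pos_left hprod (Real.exp_pos _).le

end Literature.MathematicalPhysics.QuantumFieldTheory.Balaban1983to89.B1Eq324BenfattoSpecialisation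

end
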